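/-
Copyright (c) 2026 the pub-hodgecm-mathlib formalisation cell (harness21).  Prover seat hodgecm-mathlib-F0P3a-p01 (g31), req620 Track A «(D-RAM) FOUR-FRAME» squad
(unit U3_Laws, MS ROAD A; brick N «abelian index identity» of `F0/P3c/LH4/LH4-p11/g0/MS-ROAD-A-BRICKS.v2.LH4p11g0.md` (MS first seat LH4-p11 (g0)), dealer LH4-plan (g10)).  2026-09-03.
-/
import Mathlib.GroupTheory.Index
import HarnessLib

/-!
# Crux `H413`, line LH4 «(D-RAM) FOUR-FRAME» road — unit U3_Laws (iii), MS ROAD A brick N: THE ABELIAN INDEX IDENTITY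
# `[S ∩ U : N(S)] · [ker N : ker N ∩ S] · [U : S ∩ U] = [U : N(G)] · [G : S]` (the three-line index chase of the orbit count, step (3)(d))

Cell `hodgecm-mathlib` (D-0151), FLOOR 0, crux item H413 = `stmt-HodgeConjecture-24833`, route of record `HCCMUnconditional`; squad F0∕P3c∕LH4 (req618∕req620).  THEOREMS ONLY
(no `def`, no instance, no notation, no `sorry`, default heartbeats; Mathlib-only imports); lane `--supports stmt-HodgeConjecture-24833 --as helper` (count-neutral).  Target of the
road: U3 ED. 4 §S-R `stub_U3_stableModelSum` (the eight-class model sum (MS)); finite form (S-fin) in `F0/P3c/LH4/LH4-p10/g0/MEMO-stableLaw-finite.v1.LH4p10g0.md` §2 (3)(d).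

WHAT IS PROVED (pure group theory; every index is Mathlib's `Subgroup.index ∕ relIndex : ℕ`, `0` = infinite).
* §1 (any groups `G`, `G′`, any `f : G →* G′`, any `S ≤ G`): `relIndex_map_range_eq_index_sup_ker` — `[f(G) : f(S)] = [G : S·ker f]` (`(S.map f).relIndex f.range = (S ⊔ f.ker).index`;
  ★ `Subgroup.index_comap` + `comap_map_eq`); `index_eq_index_sup_ker_mul_relIndex_ker` (`S` normal) — `[G : S] = [G : S·ker f] · [ker f : ker f ∩ S]`; hence
  `index_eq_relIndex_map_mul_relIndex_ker` — **`[G : S] = [f(G) : f(S)] · [ker f : ker f ∩ S]`**.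
* §2 HEAD `relIndex_map_mul_relIndex_ker_mul_relIndex_eq` (commutative `G`, `N : G →* G` with `N(G) ≤ U`, `N(S) ≤ S`):
  **`[S ∩ U : N(S)] · [ker N : ker N ∩ S] · [U : S ∩ U] = [U : N(G)] · [G : S]`**, UNCONDITIONALLY in `ℕ` — no finiteness hypothesis is needed because every step is one of
  Mathlib's index identities (`relIndex_mul_relIndex` twice along `N(S) ≤ S ∩ U ≤ U` and `N(S) ≤ N(G) ≤ U`, then §1); with finite `[G : S]` and `[U : N(G)]` all five factors are
  the honest finite indices.  READING (MEMO §2 (3)(d)): `G = 𝒯 = (𝒪_E^×)³`, `N = ` the norm `z ↦ z·σ(z)`, `U = 𝒰 = (𝒪_F^×)³ ⊇ N(𝒯)` with `[𝒰 : N𝒯] = 8`, `S = S̃(M)` the diagonal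
  stabiliser of a lattice (`σ̃`-stable, so `N(S) ⊆ S`), `ker N = T_u`: `[S_F : N S̃]·[T_u : T_u ∩ S̃]·[𝒰 : S_F] = 8·[𝒯 : S̃]` — the identity that converts the per-orbit fibre counts of
  (3)(b)(c) into the weighted sum `8·Σ 1∕[𝒰 : S_F(M)]` of (S-fin)₀; stated so that the (3c-iii) assembly can quote it verbatim (any orientation of `⊓` via `inf_comm`).
HONEST LABEL.  Count-neutral (`--supports`); nothing printed is asserted; (MS) stays a PROVER TARGET; the verdict of record for (D-RAM) stays PRINT [LanglandsShelstad1989 Thm. p. 484 ∕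
Rogawski1990 Prop. 4.9.1 (a)] ∕ XL; `HC_CM` is proved only modulo the 7 printed citations (2 remaining named inputs: hLiu418 = `stmt-HodgeConjecture-24832`, h413 =
`stmt-HodgeConjecture-24833`) until rung 0 closes.

## References
* [Kottwitz1986BaseChangeUnits] R. E. Kottwitz, *Base change for unit elements of Hecke algebras*, Compositio Math. 60 (1986), §1 pp. 240–241 (fixed-lattice counting and the
  index bookkeeping of norm-one tori).
* [Serre1979] J.-P. Serre, *Local Fields*, GTM 67 (1979), Ch. V §3 (norm indices of unit groups; the Herbrand-quotient style index chase).
-/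

set_option autoImplicit false

namespace Summit.HodgeConjecture.HodgeConjecture.Cruxes.H413.F0P3cDyRamAbelianIndexIdentity

open Subgroup

/-! ## §1  `[G : S] = [f(G) : f(S)] · [ker f : ker f ∩ S]` -/

section General

variable {G G' : Type*} [Group G] [Group G'] (f : G →* G') (S : Subgroup G)

/-- **`[f(G) : f(S)] = [G : S·ker f]`**: the index of `f(S)` in the range of `f` is the index of `S ⊔ ker f = f⁻¹(f(S))` in `G` (Mathlib: `index_comap` + `comap_map_eq`).
[cite: Serre1979, Ch. V §3] -/
theorem relIndex_map_range_eq_index_sup_ker : (S.map f).relIndex f.range = (S ⊔ f.ker).index := by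
  rw [← index_comap, comap_map_eq]

/-- **`[G : S] = [G : S·ker f] · [ker f : ker f ∩ S]`** for normal `S` (second isomorphism theorem in index form: `[S·K : S] = [K : K ∩ S]`, Mathlib `relIndex_sup_left`, then
`relIndex_mul_index`). [cite: Serre1979, Ch. V §3] -/
theorem index_eq_index_sup_ker_mul_relIndex_ker [S.Normal] : S.index = (S ⊔ f.ker).index * S.relIndex f.ker := by
  rw [← relIndex_sup_left f.ker S, mul_comm, relIndex_mul_index le_sup_left]

/-- **`[G : S] = [f(G) : f(S)] · [ker f : ker f ∩ S]`** for normal `S` (the two previous identities). [cite: Serre1979, Ch. V §3] -/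
theorem index_eq_relIndex_map_mul_relIndex_ker [S.Normal] : S.index = (S.map f).relIndex f.range * S.relIndex f.ker := by
  rw [relIndex_map_range_eq_index_sup_ker, index_eq_index_sup_ker_mul_relIndex_ker f S]

end General

/-! ## §2  The head: the abelian index identity of the orbit count -/

/-- **«ABELIAN INDEX IDENTITY» (MS ROAD A brick N; MEMO-stableLaw-finite §2 (3)(d)).**  For a commutative group `G`, an endomorphism `N : G →* G` whose image lies in a subgroup
`U`, and a subgroup `S` with `N(S) ⊆ S`:  `[S ∩ U : N(S)] · [ker N : ker N ∩ S] · [U : S ∩ U] = [U : N(G)] · [G : S]` — unconditionally in `ℕ` (Mathlib's `0 = ∞` conventions;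
with `[G : S]` and `[U : N(G)]` finite every factor is a finite index).  Reading: `G = 𝒯`, `U = 𝒰`, `S = S̃(M)`, `ker N = T_u`, `[𝒰 : N𝒯] = 8` gives
`[S_F : N S̃]·[T_u : T_u ∩ S̃]·[𝒰 : S_F] = 8·[𝒯 : S̃]`. [cite: Kottwitz1986BaseChangeUnits, §1 pp. 240–241] [cite: Serre1979, Ch. V §3] -/
theorem relIndex_map_mul_relIndex_ker_mul_relIndex_eq {G : Type*} [CommGroup G] (N : G →* G) (U S : Subgroup G)
    (hNU : N.range ≤ U) (hNS : S.map N ≤ S) :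
    (S.map N).relIndex (S ⊓ U) * S.relIndex N.ker * (S ⊓ U).relIndex U = N.range.relIndex U * S.index := by
  have h1 : S.map N ≤ S ⊓ U := le_inf hNS ((map_le_range N S).trans hNU)
  have h2 : (S.map N).relIndex (S ⊓ U) * (S ⊓ U).relIndex U = (S.map N).relIndex U :=
    relIndex_mul_relIndex (S.map N) (S ⊓ U) U h1 inf_le_right
  have h3 : (S.map N).relIndex N.range * N.range.relIndex U = (S.map N).relIndex U :=
    relIndex_mul_relIndex (S.map N) N.range U (map_le_range N S) hNU
  calc (S.map N).relIndex (S ⊓ U) * S.relIndex N.ker * (S ⊓ U).relIndex U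
        = (S.map N).relIndex (S ⊓ U) * (S ⊓ U).relIndex U * S.relIndex N.ker := mul_right_comm _ _ _
    _ = (S.map N).relIndex N.range * N.range.relIndex U * S.relIndex N.ker := by rw [h2, h3]
    _ = N.range.relIndex U * ((S.map N).relIndex N.range * S.relIndex N.ker) := by
          rw [mul_comm ((S.map N).relIndex N.range) (N.range.relIndex U), mul_assoc]
    _ = N.range.relIndex U * S.index := by rw [← index_eq_relIndex_map_mul_relIndex_ker N S]

/-- The same identity with the intersections written `U ⊓ S`. [cite: Kottwitz1986BaseChangeUnits, §1 pp. 240–241] -/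
theorem relIndex_map_mul_relIndex_ker_mul_relIndex_eq' {G : Type*} [CommGroup G] (N : G →* G) (U S : Subgroup G)
    (hNU : N.range ≤ U) (hNS : S.map N ≤ S) :
    (S.map N).relIndex (U ⊓ S) * S.relIndex N.ker * (U ⊓ S).relIndex U = N.range.relIndex U * S.index := by
  rw [inf_comm]
  exact relIndex_map_mul_relIndex_ker_mul_relIndex_eq N U S hNU hNS

/-- **FINITE READING**: if `[G : S]` and `[U : N(G)]` are finite (non-zero), then so are the three factors on the left (each divides a finite index), and the identity is one of
honest finite indices; in particular `[S ∩ U : N(S)] · [ker N : ker N ∩ S] · [U : S ∩ U] ≠ 0`. [cite: Kottwitz1986BaseChangeUnits, §1 pp. 240–241] -/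
theorem relIndex_map_mul_relIndex_ker_mul_relIndex_ne_zero {G : Type*} [CommGroup G] (N : G →* G) (U S : Subgroup G)
    (hNU : N.range ≤ U) (hNS : S.map N ≤ S) (hS : S.index ≠ 0) (hU : N.range.relIndex U ≠ 0) :
    (S.map N).relIndex (S ⊓ U) * S.relIndex N.ker * (S ⊓ U).relIndex U ≠ 0 := by
  rw [relIndex_map_mul_relIndex_ker_mul_relIndex_eq N U S hNU hNS]
  exact mul_ne_zero hU hS

end Summit.HodgeConjecture.HodgeConjecture.Cruxes.H413.F0P3cDyRamAbelianIndexIdentity
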